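import Mathlib
import HarnessLib
import Summits.QuantumAdvantage.QuantumAdvantage.Theorems.DominoLawB

/-!
# The DOMINO LAW, part C: the ball lemma and the designed centre (lens 4 g26, node 4)

Part C.  §6 THE BALL LEMMA `exists_near_ne_zero`: a non-zero function of degree `≤ D` is non-zero within Hamming distance `D` of any
centre (Möbius inversion on the ball, the tree's `moebius_inversion` / `mcoeff_eq_zero_of_mem_lowDegOn` BY NAME, transported by the
centre-keyed reflection `xv`); §7 window counts (`SegMove.wseg` BY NAME); §8 THE DESIGNED CENTRE `ctr h` for fired cuts
`h_0 < h_1 < ⋯` pairwise `≥ 3` apart — domino `(1,0)` at `(h_j − 1, h_j)` followed by a filler of weight `≡ 1 − gap (mod 3)` — on which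
consecutive domino PHASES advance by one (`phase_succ_mod`); §9 an input with complementary pairs at the domino positions lies on its
own domino cube (`dom_self`, `walkExp_dom_orient`).  Supports stmt-QuantumAdvantage-28487 (record).
-/

set_option autoImplicit false
set_option linter.dupNamespace false

namespace Summit.QuantumAdvantage.QuantumAdvantage.Theorems.DominoLaw
open Classical
open Finset
open Summit.QuantumAdvantage.AdviceFreeQNC0
open Summit.QuantumAdvantage.AdviceFreeQNC0.JLinPeel
open Summit.QuantumAdvantage.QuantumAdvantage.Theorems.PhaseParity
open Summit.QuantumAdvantage.QuantumAdvantage.Theorems.GapLaw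
open Literature.Computability.MetaComplexity Literature.Computability.MetaComplexity.Smolensky

noncomputable section

section Ball

variable {F : Type*} [Field F] {n : ℕ}

/-- Reflection of the cube in the coordinates where `b` is `1`: `x ↦ x ⊕ b`. -/
def xv (b x : Fin n → Bool) : Fin n → Bool := fun t => if b t = true then !x t else x t

/-- Reflections are involutions. -/
theorem xv_xv (b x : Fin n → Bool) : xv b (xv b x) = x := by
  funext t; unfold xv; cases b t <;> cases x t <;> rfl

/-- Reflections preserve the degree. -/
theorem comp_xv_mem_lowDeg (b : Fin n → Bool) {D : ℕ} {g : CubeFn F n} (hg : g ∈ lowDeg F n D) :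
    (fun x => g (xv b x)) ∈ lowDeg F n D := by
  refine comp_mem_lowDeg_of_coord (xv b) (fun t => ?_) hg
  by_cases hb : b t = true
  · have e : (fun x : Fin n → Bool => if xv b x t = true then (1 : F) else 0) = 1 - mono F {t} := by
      funext x
      rw [Pi.sub_apply, Pi.one_apply]
      unfold mono xv
      rw [Finset.prod_singleton, if_pos hb]
      cases x t <;> simp
    rw [e]
    exact Submodule.sub_mem _ (one_mem_lowDeg 1) (mono_mem_lowDeg (by simp))
  · have e : (fun x : Fin n → Bool => if xv b x t = true then (1 : F) else 0) = mono F {t} := by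
      funext x
      unfold mono xv
      rw [Finset.prod_singleton, if_neg hb]
    rw [e]
    exact mono_mem_lowDeg (by simp)

/-- The distance from `x ⊕ b` to `b` is `|x|`. -/
theorem card_ne_xv (b x : Fin n → Bool) : (univ.filter fun t => xv b x t ≠ b t).card = wt x := by
  unfold wt
  congr 1
  refine Finset.filter_congr fun t _ => ?_
  unfold xv
  cases b t <;> cases x t <;> simp

/-- **Ball lemma at the origin**: a function of degree `≤ D` vanishing at every point of weight `≤ D` is zero
(Möbius inversion: tree `moebius_inversion`, `mcoeff_eq_zero_of_mem_lowDegOn` BY NAME). -/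
theorem eq_zero_of_lowDeg_vanish_ball_zero {D : ℕ} {g : CubeFn F n} (hg : g ∈ lowDeg F n D)
    (hvan : ∀ x : Fin n → Bool, wt x ≤ D → g x = 0) : g = 0 := by
  rw [lowDeg_eq_lowDegOn] at hg
  funext x
  rw [Pi.zero_apply, ← indVec_support x, moebius_inversion g]
  refine Finset.sum_eq_zero fun S _ => ?_
  by_cases hD : D < S.card
  · exact mcoeff_eq_zero_of_mem_lowDegOn hg hD
  · unfold mcoeff
    refine Finset.sum_eq_zero fun T hT => ?_
    have hTc : T.card ≤ D := le_trans (Finset.card_le_card (Finset.mem_powerset.1 hT)) (by omega)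
    have hw : wt (indVec T) ≤ D := by
      have h1 : hwt (indVec T) = T.card := hwt_indVec T
      have e : wt (indVec T) = hwt (indVec T) := rfl
      omega
    rw [hvan _ hw, mul_zero]

/-- **Ball lemma**: a non-zero function of degree `≤ D` is non-zero at some point within Hamming distance `D` of any
prescribed centre `b`. -/
theorem exists_near_ne_zero {D : ℕ} {g : CubeFn F n} (hg : g ∈ lowDeg F n D) (hne : g ≠ 0)
    (b : Fin n → Bool) : ∃ u, (univ.filter fun t => u t ≠ b t).card ≤ D ∧ g u ≠ 0 := by
  by_contra hcon
  push Not at hcon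
  have hzero := eq_zero_of_lowDeg_vanish_ball_zero (comp_xv_mem_lowDeg b hg)
    (fun x hx => hcon (xv b x) (by rw [card_ne_xv]; exact hx))
  apply hne
  funext y
  have h1 := congr_fun hzero (xv b y)
  simp only [xv_xv, Pi.zero_apply] at h1
  rw [h1, Pi.zero_apply]

end Ball

/-! ### §7 Window counts (the tree's `SegMove.wseg`, `SegMove.card_window`, `SegMove.walkExp_add_wseg`, BY NAME) -/

section Blocks

variable {n : ℕ}

/-- the window count only sees the window. -/
theorem wseg_congr (u v : Fin n → Bool) (g g' : ℕ) (huv : ∀ t : Fin n, g ≤ t.val → t.val < g' → u t = v t) :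
    SegMove.wseg u g g' = SegMove.wseg v g g' := by
  unfold SegMove.wseg
  congr 1
  refine Finset.filter_congr fun t _ => ?_
  constructor
  · rintro ⟨⟨h1, h2⟩, h3⟩
    exact ⟨⟨h1, h2⟩, by rw [← huv t h1 h2]; exact h3⟩
  · rintro ⟨⟨h1, h2⟩, h3⟩
    exact ⟨⟨h1, h2⟩, by rw [huv t h1 h2]; exact h3⟩

end Blocks

/-! ### §8 The designed centre: dominoes at the fired cuts, fillers making the phases advance by one -/

section Centre

variable {n k : ℕ} (h : Fin k → ℕ) (hlo : ∀ j, 1 ≤ h j) (hhi : ∀ j, h j + 1 ≤ n)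
  (hsep : ∀ j j' : Fin k, j < j' → h j + 3 ≤ h j')

/-- filler weight after domino `j`: `≡ 1 − m_j (mod 3)` where `m_j = h_{j+1} − h_j − 2` is the filler length. -/
def fill (j : Fin k) : ℕ :=
  if hj : j.val + 1 < k then (4 - (h ⟨j.val + 1, hj⟩ - h j - 2) % 3) % 3 else 0

/-- fillers weigh at most two. -/
theorem fill_le_two (j : Fin k) : fill h j ≤ 2 := by
  unfold fill; split_ifs <;> omega

/-- **The designed centre** `b`: domino `j` at positions `(h_j − 1, h_j)` oriented `(1, 0)`, then `fill_j` ones, then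
zeros up to the next domino. -/
def ctr : Fin n → Bool := fun t =>
  decide (∃ j : Fin k, t.val + 1 = h j) || decide (∃ j : Fin k, h j + 1 ≤ t.val ∧ t.val < h j + 1 + fill h j)

include hsep in
/-- the cut positions are monotone. -/
theorem h_le_of_le {j j' : Fin k} (hjj : j ≤ j') : h j ≤ h j' := by
  rcases hjj.lt_or_eq with hlt | heq
  · have := hsep j j' hlt; omega
  · rw [heq]

/-- first bit of a domino of the centre. -/
theorem ctr_of_succ_eq (t : Fin n) (j : Fin k) (ht : t.val + 1 = h j) : ctr h t = true := by
  unfold ctr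
  rw [Bool.or_eq_true]
  exact Or.inl (decide_eq_true ⟨j, ht⟩)

/-- filler bits of the centre. -/
theorem ctr_filler (t : Fin n) (j : Fin k) (h1 : h j + 1 ≤ t.val) (h2 : t.val < h j + 1 + fill h j) :
    ctr h t = true := by
  unfold ctr
  rw [Bool.or_eq_true]
  exact Or.inr (decide_eq_true ⟨j, h1, h2⟩)

include hsep in
/-- second bit of a domino of the centre. -/
theorem ctr_at (t : Fin n) (j : Fin k) (ht : t.val = h j) : ctr h t = false := by
  unfold ctr
  rw [Bool.or_eq_false_iff, decide_eq_false_iff_not, decide_eq_false_iff_not]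
  refine ⟨fun ⟨j', hj'⟩ => ?_, fun ⟨j', hj1, hj2⟩ => ?_⟩
  · rcases lt_trichotomy j j' with hl | he | hg
    · have := hsep j j' hl; omega
    · subst he; omega
    · have := hsep j' j hg; omega
  · have hf := fill_le_two h j'
    rcases lt_trichotomy j j' with hl | he | hg
    · have := hsep j j' hl; omega
    · subst he; omega
    · have := hsep j' j hg; omega

include hsep in
/-- the zero part of block `j` of the centre. -/
theorem ctr_zero_part (t : Fin n) (j j₁ : Fin k) (hj₁ : j₁.val = j.val + 1) (h1 : h j + 1 + fill h j ≤ t.val)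
    (h2 : t.val + 2 ≤ h j₁) : ctr h t = false := by
  unfold ctr
  rw [Bool.or_eq_false_iff, decide_eq_false_iff_not, decide_eq_false_iff_not]
  refine ⟨fun ⟨j', hj'⟩ => ?_, fun ⟨j', hj1', hj2'⟩ => ?_⟩
  · rcases le_or_gt j' j with hl | hg
    · have := h_le_of_le h hsep hl; omega
    · have hle : j₁ ≤ j' := Fin.le_iff_val_le_val.2 (by have := Fin.lt_def.1 hg; omega)
      have := h_le_of_le h hsep hle; omega
  · have hf := fill_le_two h j'
    rcases lt_trichotomy j j' with hl | he | hg
    · have hle : j₁ ≤ j' := Fin.le_iff_val_le_val.2 (by have := Fin.lt_def.1 hl; omega)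
      have := h_le_of_le h hsep hle; omega
    · subst he; omega
    · have := hsep j' j hg; omega

include hlo hhi hsep in
/-- **block count**: the window `[h_j − 1, h_{j+1} − 1)` of the centre carries exactly `1 + fill_j` ones. -/
theorem wseg_ctr_block (j j₁ : Fin k) (hj₁ : j₁.val = j.val + 1) :
    SegMove.wseg (n := n) (ctr h) (h j - 1) (h j₁ - 1) = 1 + fill h j := by
  have hjj : h j + 3 ≤ h j₁ := hsep j j₁ (Fin.lt_def.2 (by omega))
  have hk : j.val + 1 < k := by have := j₁.isLt; omega
  have hfl : fill h j ≤ h j₁ - h j - 2 := by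
    unfold fill
    rw [dif_pos hk]
    have he : (⟨j.val + 1, hk⟩ : Fin k) = j₁ := Fin.ext (by show j.val + 1 = j₁.val; omega)
    rw [he]
    omega
  have hl := hlo j
  have hn := hhi j₁
  unfold SegMove.wseg
  have hset : (univ.filter fun t : Fin n => (h j - 1 ≤ t.val ∧ t.val < h j₁ - 1) ∧ ctr h t = true) =
      (univ.filter fun t : Fin n => t.val = h j - 1) ∪
        (univ.filter fun t : Fin n => h j + 1 ≤ t.val ∧ t.val < h j + 1 + fill h j) := by
    ext t
    simp only [Finset.mem_filter, Finset.mem_univ, true_and, Finset.mem_union]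
    constructor
    · rintro ⟨⟨ht1, ht2⟩, hct⟩
      by_cases e1 : t.val = h j - 1
      · exact Or.inl e1
      · by_cases e2 : t.val = h j
        · rw [ctr_at h hsep t j e2] at hct
          exact absurd hct Bool.false_ne_true
        · by_cases e3 : t.val < h j + 1 + fill h j
          · exact Or.inr ⟨by omega, e3⟩
          · rw [ctr_zero_part h hsep t j j₁ hj₁ (by omega) (by omega)] at hct
            exact absurd hct Bool.false_ne_true
    · rintro (e1 | ⟨e2, e3⟩)
      · exact ⟨⟨by omega, by omega⟩, ctr_of_succ_eq h t j (by omega)⟩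
      · exact ⟨⟨by omega, by omega⟩, ctr_filler h t j e2 e3⟩
  have hsing : (univ.filter fun t : Fin n => t.val = h j - 1) = {⟨h j - 1, by omega⟩} := by
    ext t
    simp only [Finset.mem_filter, Finset.mem_univ, true_and, Finset.mem_singleton, Fin.ext_iff]
  rw [hset, Finset.card_union_of_disjoint (Finset.disjoint_filter.2 fun t _ e1 h2 => by omega), hsing,
    Finset.card_singleton, SegMove.card_window (show h j + 1 + fill h j ≤ n by omega)]
  omega

/-- the PHASE of domino `j` at input `u`: `R_j(u) = c + h_j + e_{h_j − 1}(u)`; the middle cut `h_j` of an intact domino is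
live iff `R_j + [orientation] ≢ 0`, so the domino is ACTIVE iff `R_j ≢ 1 (mod 3)`. -/
def phase (c : ℕ) (u : Fin n → Bool) (j : Fin k) : ℕ := c + h j + walkExp u (h j - 1)

include hlo hhi hsep in
/-- **phases advance by one** along consecutive dominoes, at every input agreeing with the centre on the block between. -/
theorem phase_succ_mod (c : ℕ) (u : Fin n → Bool) (j j₁ : Fin k) (hj₁ : j₁.val = j.val + 1)
    (hagree : ∀ t : Fin n, h j - 1 ≤ t.val → t.val < h j₁ - 1 → u t = ctr h t) :
    phase h c u j₁ % 3 = (phase h c u j + 1) % 3 := by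
  have hjj : h j + 3 ≤ h j₁ := hsep j j₁ (Fin.lt_def.2 (by omega))
  have hk : j.val + 1 < k := by have := j₁.isLt; omega
  have hfm : (h j₁ - h j - 2 + fill h j + 3) % 3 = 1 := by
    unfold fill
    rw [dif_pos hk]
    have he : (⟨j.val + 1, hk⟩ : Fin k) = j₁ := Fin.ext (by show j.val + 1 = j₁.val; omega)
    rw [he]
    omega
  have hbc : SegMove.wseg u (h j - 1) (h j₁ - 1) = 1 + fill h j := by
    rw [wseg_congr u (ctr h) _ _ hagree]
    exact wseg_ctr_block h hlo hhi hsep j j₁ hj₁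
  have hl := hlo j
  unfold phase
  rw [SegMove.walkExp_add_wseg u (show h j - 1 ≤ h j₁ - 1 by omega), hbc]
  omega

end Centre

/-! ### §9 Background inputs with complementary pairs lie on their own domino cube -/

section CubeSelf

variable {n k : ℕ} (a : Fin k → ℕ) (hsep : ∀ i j : Fin k, i < j → a i + 2 ≤ a j) (hbd : ∀ i, a i + 2 ≤ n)

include hsep hbd in
/-- an input whose pairs at the domino positions are complementary is a point of its own domino cube. -/
theorem dom_self (u : Fin n → Bool)
    (hint : ∀ i, u ⟨a i + 1, by have := hbd i; omega⟩ = !u ⟨a i, by have := hbd i; omega⟩) :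
    dom a u (fun i => u ⟨a i, by have := hbd i; omega⟩) = u := by
  funext t
  by_cases h1 : ∃ i, a i = t.val
  · obtain ⟨i, hi⟩ := h1
    have ht : t = ⟨a i, by have := hbd i; omega⟩ := Fin.ext hi.symm
    rw [ht, dom_fst a hsep]
  · by_cases h2 : ∃ i, a i + 1 = t.val
    · obtain ⟨i, hi⟩ := h2
      have ht : t = ⟨a i + 1, by have := hbd i; omega⟩ := Fin.ext hi.symm
      rw [ht, dom_snd a hsep, hint i]
    · exact dom_off a u _ t (fun i hi => h1 ⟨i, hi⟩) (fun i hi => h2 ⟨i, hi⟩)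

include hsep hbd in
/-- … so the walk of any point of the cube agrees with the walk of `u` off the middle cuts. -/
theorem walkExp_dom_orient (u : Fin n → Bool)
    (hint : ∀ i, u ⟨a i + 1, by have := hbd i; omega⟩ = !u ⟨a i, by have := hbd i; omega⟩)
    (o : Fin k → Bool) {g : ℕ} (hg : ∀ i, a i + 1 ≠ g) : walkExp (dom a u o) g = walkExp u g := by
  have e := walkExp_dom_indep a hsep hbd u hg _ o (fun i => u ⟨a i, by have := hbd i; omega⟩) rfl
  rw [e, dom_self a hsep hbd u hint]

end CubeSelf

end

end Summit.QuantumAdvantage.QuantumAdvantage.Theorems.DominoLaw
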